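import Mathlib
import HarnessLib
import Literature.Computability.AlgebraicComplexity.PatternExpressions
import Literature.Combinatorics.SimpleGraph.TreeDecomposition
import Summits.ValiantsHypothesis.ValiantsHypothesis.Theorems.MonotoneRestorationMonotoneRestorationQPLinearWidthFourCycleSeparates

/-!
# Route MonotoneRestoration, crux `MonotoneRestorationQP` (stmt-15886) / crux `OrbitRestorationQP`
# (stmt-18293, K1) — FOLDING: at level `n = 2` the `4`-CYCLE polynomial (treewidth `2`) is a
# combination of TREE homomorphism polynomials (treewidth `1`) of patterns with MORE vertices than
# the level

Helper file (`--supports stmt-ValiantsHypothesis-15886`), def-free.  K1 `stub_narrowExpansionVP` (line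
`narrow-expansion`) and the NARROW currency of line `linear-width` quantify over bipartite patterns of
bounded TREEWIDTH but UNBOUNDED SIZE.  At a fixed level `n`, homomorphism polynomials of patterns with
more than `n` vertices a side fold onto those of their quotients, and quotients RAISE treewidth — so the
narrow span `S_k(n) = span{hom_{F,n} : tw F < k}` can contain the homomorphism polynomials of admissible
patterns of treewidth `≥ k`.  This file certifies the smallest instance:

* `treewidth_le_one_of_pathListing` — a graph listed along a Hamiltonian path carrying all its edges
  has treewidth `≤ 1`; hence (`treewidth_F₁/F₂/F₃_le_one`) the three tree patterns below have treewidth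
  `≤ 1`;
* `homPoly_fourCycle_two` — **`hom_{C_4,2} = 2·hom_{F₁,2} − 2·hom_{F₂,2} + hom_{F₃,2}`** in
  `ℂ[x₀₀, x₀₁, x₁₀, x₁₁]`, with trees `F₁ = {r₀c₀², r₁c₀²}`, `F₂ = {r₀c₀², r₁c₀, r₁c₁}`,
  `F₃ = {r₀c₀, r₀c₁, r₁c₀, r₁c₂}` (`F₃` has three column vertices: the fold);
* `homPoly_fourCycle_mem_narrowSpan_one` — so `hom_{C_4,2}` lies in the narrow span of width `1` at
  level `2` (K1's set with bound `1`, verbatim shape), although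
* `two_le_treewidth_fourCycle` — the `4`-cycle pattern itself has treewidth `≥ 2` (it separates the
  treewidth-`< 2`-indistinguishable pair of `…ForestBlind*.lean`: `24 ≠ 32`).

Reading for the planners: (i) DPS26 Lemma 8.18 (uniqueness of ADMISSIBLE expansions,
`HomExpansionUnique`) does not control membership in K1's narrow span — non-admissible low-width patterns
contribute; (ii) the question "(Q1) determined ⇒ narrow?" of `…DeterminedVsNarrow.lean` and K1 itself
must be read with folding in mind: at level `2`, width `1` already captures a treewidth-`2` polynomial.
(That folding cannot reach everything is the tree's `perPoly_not_mem_narrowSpan` via Dawar–Wilsenach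
Thm 7.1.)  Honest label: calibration; no stub closed; VP ≠ VNP not moved.
[cite: DwivediPagoSeppelt2026, §8 (Lemma 8.18)]
-/

-- `Summit.ValiantsHypothesis.ValiantsHypothesis.…` is the tree's mandated namespace (Sub = Summit).
set_option linter.dupNamespace false

noncomputable section

namespace Summit.ValiantsHypothesis.ValiantsHypothesis.Theorems

namespace Folding

open Literature.Computability.AlgebraicComplexity MvPolynomial SimpleGraph

/-! ### Treewidth `≤ 1` from a path listing -/

/-- **A graph with a Hamiltonian listing covering all edges consecutively has treewidth `≤ 1`** (path
decomposition with bags `{v t, v (t+1)}`, `treewidth_le_of_intervals`). [folklore] -/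
theorem treewidth_le_one_of_pathListing {V : Type*} [Fintype V] [DecidableEq V] (G : SimpleGraph V)
    {k : ℕ} (v : Fin (k + 2) → V) (hsurj : Function.Surjective v) (hinj : Function.Injective v)
    (hedge : ∀ x y, G.Adj x y → ∃ t : Fin (k + 1),
      (x = v t.castSucc ∧ y = v t.succ) ∨ (y = v t.castSucc ∧ x = v t.succ)) :
    Literature.Combinatorics.SimpleGraph.treewidth G ≤ 1 := by
  classical
  refine Literature.Combinatorics.SimpleGraph.treewidth_le_of_intervals G
    (fun t : Fin (k + 1) => ({v t.castSucc, v t.succ} : Finset V)) ?_ ?_ ?_ ?_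
  · intro x y hxy
    obtain ⟨t, h⟩ := hedge x y hxy
    refine ⟨t, ?_⟩
    rcases h with ⟨rfl, rfl⟩ | ⟨rfl, rfl⟩ <;> simp
  · intro x
    obtain ⟨s, rfl⟩ := hsurj x
    rcases Fin.eq_castSucc_or_eq_last s with ⟨t, rfl⟩ | rfl
    · exact ⟨t, by simp⟩
    · exact ⟨Fin.last k, by simp [Fin.succ_last]⟩
  · intro x
    obtain ⟨s, rfl⟩ := hsurj x
    have key : ∀ t : Fin (k + 1),
        v s ∈ ({v t.castSucc, v t.succ} : Finset V) ↔ ((s : ℕ) = t ∨ (s : ℕ) = t + 1) := by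
      intro t
      rw [Finset.mem_insert, Finset.mem_singleton, hinj.eq_iff, hinj.eq_iff, Fin.ext_iff,
        Fin.ext_iff, Fin.val_castSucc, Fin.val_succ]
    refine ⟨fun t₁ ht₁ t₂ ht₂ t ht => ?_⟩
    rw [Set.mem_setOf_eq, key] at ht₁ ht₂ ⊢
    have h1 : (t₁ : ℕ) ≤ t := ht.1
    have h2 : (t : ℕ) ≤ t₂ := ht.2
    omega
  · intro t
    exact Finset.card_le_two


/-! ### Sums over small function spaces -/

/-- Sums over `Fin 1 → α`. [folklore] -/
theorem sum_arrow_fin_one {M : Type*} [AddCommMonoid M] {α : Type*} [Fintype α]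
    (F : (Fin 1 → α) → M) : ∑ h, F h = ∑ i : α, F (fun _ => i) :=
  Fintype.sum_equiv (Equiv.funUnique (Fin 1) α) _ _ fun h => by
    congr 1; funext j; simp [Fin.eq_zero j]

/-- Sums over `Fin 2 → α`. [folklore] -/
theorem sum_arrow_fin_two {M : Type*} [AddCommMonoid M] {α : Type*} [Fintype α]
    (F : (Fin 2 → α) → M) : ∑ h, F h = ∑ i : α, ∑ j : α, F ![i, j] := by
  rw [← Fintype.sum_prod_type']
  exact Fintype.sum_equiv (finTwoArrowEquiv α) _ _ fun h => by
    congr 1; funext j; fin_cases j <;> simp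

/-- Sums over `Fin 3 → α`. [folklore] -/
theorem sum_arrow_fin_three {M : Type*} [AddCommMonoid M] {α : Type*} [Fintype α]
    (F : (Fin 3 → α) → M) : ∑ h, F h = ∑ i : α, ∑ j : α, ∑ l : α, F ![i, j, l] := by
  rw [Fintype.sum_equiv (Fin.consEquiv fun _ : Fin 3 => α).symm F (fun p => F (Fin.cons p.1 p.2))
    fun h => by
      show F h = F (Fin.cons (h 0) (Fin.tail h))
      rw [Fin.cons_self_tail]]
  rw [Fintype.sum_prod_type]
  refine Finset.sum_congr rfl fun i _ => ?_
  rw [sum_arrow_fin_two]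
  rfl


/-! ### The three trees have treewidth `≤ 1` -/

/-- `F₁ = {r₀c₀², r₁c₀²}` on `Fin 2 ⊔ Fin 1` is the path `r₀ – c₀ – r₁`: treewidth `≤ 1`. [folklore] -/
theorem treewidth_F₁_le_one :
    Literature.Combinatorics.SimpleGraph.treewidth
      (SimpleGraph.fromRel fun u v : Fin 2 ⊕ Fin 1 =>
        ∃ p ∈ (((0, 0) ::ₘ (0, 0) ::ₘ (1, 0) ::ₘ {(1, 0)}) : Multiset (Fin 2 × Fin 1)),
          u = Sum.inl p.1 ∧ v = Sum.inr p.2) ≤ 1 := by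
  refine treewidth_le_one_of_pathListing _ (k := 1) ![Sum.inl 0, Sum.inr 0, Sum.inl 1]
    (by decide) (by decide) fun x y hxy => ?_
  rw [SimpleGraph.fromRel_adj] at hxy
  rcases hxy.2 with ⟨p, hp, rfl, rfl⟩ | ⟨p, hp, rfl, rfl⟩ <;>
    simp only [Multiset.mem_cons, Multiset.mem_singleton] at hp <;>
    rcases hp with rfl | rfl | rfl | rfl <;> decide

/-- `F₂ = {r₀c₀², r₁c₀, r₁c₁}` on `Fin 2 ⊔ Fin 2` is the path `r₀ – c₀ – r₁ – c₁`: treewidth `≤ 1`.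
[folklore] -/
theorem treewidth_F₂_le_one :
    Literature.Combinatorics.SimpleGraph.treewidth
      (SimpleGraph.fromRel fun u v : Fin 2 ⊕ Fin 2 =>
        ∃ p ∈ (((0, 0) ::ₘ (0, 0) ::ₘ (1, 0) ::ₘ {(1, 1)}) : Multiset (Fin 2 × Fin 2)),
          u = Sum.inl p.1 ∧ v = Sum.inr p.2) ≤ 1 := by
  refine treewidth_le_one_of_pathListing _ (k := 2) ![Sum.inl 0, Sum.inr 0, Sum.inl 1, Sum.inr 1]
    (by decide) (by decide) fun x y hxy => ?_
  rw [SimpleGraph.fromRel_adj] at hxy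
  rcases hxy.2 with ⟨p, hp, rfl, rfl⟩ | ⟨p, hp, rfl, rfl⟩ <;>
    simp only [Multiset.mem_cons, Multiset.mem_singleton] at hp <;>
    rcases hp with rfl | rfl | rfl | rfl <;> decide

/-- `F₃ = {r₀c₀, r₀c₁, r₁c₀, r₁c₂}` on `Fin 2 ⊔ Fin 3` is the path `c₁ – r₀ – c₀ – r₁ – c₂`: treewidth
`≤ 1`. [folklore] -/
theorem treewidth_F₃_le_one :
    Literature.Combinatorics.SimpleGraph.treewidth
      (SimpleGraph.fromRel fun u v : Fin 2 ⊕ Fin 3 =>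
        ∃ p ∈ (((0, 0) ::ₘ (0, 1) ::ₘ (1, 0) ::ₘ {(1, 2)}) : Multiset (Fin 2 × Fin 3)),
          u = Sum.inl p.1 ∧ v = Sum.inr p.2) ≤ 1 := by
  refine treewidth_le_one_of_pathListing _ (k := 3)
    ![Sum.inr 1, Sum.inl 0, Sum.inr 0, Sum.inl 1, Sum.inr 2] (by decide) (by decide) fun x y hxy => ?_
  rw [SimpleGraph.fromRel_adj] at hxy
  rcases hxy.2 with ⟨p, hp, rfl, rfl⟩ | ⟨p, hp, rfl, rfl⟩ <;>
    simp only [Multiset.mem_cons, Multiset.mem_singleton] at hp <;>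
    rcases hp with rfl | rfl | rfl | rfl <;> decide

/-! ### The folding identity -/

/-- **THE FOLDING IDENTITY AT LEVEL `2`.**  `hom_{C_4,2} = 2·hom_{F₁,2} − 2·hom_{F₂,2} + hom_{F₃,2}` with the
TREES `F₁ = {r₀c₀², r₁c₀²}` (on `Fin 2 ⊔ Fin 1`), `F₂ = {r₀c₀², r₁c₀, r₁c₁}` (on `Fin 2 ⊔ Fin 2`),
`F₃ = {r₀c₀, r₀c₁, r₁c₀, r₁c₂}` (a path on `Fin 2 ⊔ Fin 3` — MORE column vertices than the level). [folklore] -/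
theorem homPoly_fourCycle_two :
    homPoly (((0, 0) ::ₘ (0, 1) ::ₘ (1, 0) ::ₘ {(1, 1)}) : Multiset (Fin 2 × Fin 2)) 2 ℂ =
      2 * homPoly (((0, 0) ::ₘ (0, 0) ::ₘ (1, 0) ::ₘ {(1, 0)}) : Multiset (Fin 2 × Fin 1)) 2 ℂ
      - 2 * homPoly (((0, 0) ::ₘ (0, 0) ::ₘ (1, 0) ::ₘ {(1, 1)}) : Multiset (Fin 2 × Fin 2)) 2 ℂ
      + homPoly (((0, 0) ::ₘ (0, 1) ::ₘ (1, 0) ::ₘ {(1, 2)}) : Multiset (Fin 2 × Fin 3)) 2 ℂ := by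
  simp only [homPoly, Fintype.sum_prod_type, Multiset.map_cons, Multiset.map_singleton,
    Multiset.prod_cons, Multiset.prod_singleton, sum_arrow_fin_one, sum_arrow_fin_two,
    sum_arrow_fin_three, Fin.sum_univ_two, Matrix.cons_val_zero, Matrix.cons_val_one,
    Matrix.cons_val]
  ring

/-- **`hom_{C_4,2}` is narrow of width `1` at level `2`** (K1's set with treewidth bound `1`). [folklore] -/
theorem homPoly_fourCycle_mem_narrowSpan_one :
    homPoly (((0, 0) ::ₘ (0, 1) ::ₘ (1, 0) ::ₘ {(1, 1)}) : Multiset (Fin 2 × Fin 2)) 2 ℂ ∈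
      Submodule.span ℂ
        {p : MvPolynomial (Fin 2 × Fin 2) ℂ | ∃ (a b : ℕ) (E : Multiset (Fin a × Fin b)),
          Literature.Combinatorics.SimpleGraph.treewidth
              (SimpleGraph.fromRel fun u v : Fin a ⊕ Fin b =>
                ∃ e ∈ E, u = Sum.inl e.1 ∧ v = Sum.inr e.2) ≤ 1 ∧
            p = homPoly E 2 ℂ} := by
  rw [homPoly_fourCycle_two]
  refine Submodule.add_mem _ (Submodule.sub_mem _ ?_ ?_) ?_
  · rw [show (2 : MvPolynomial (Fin 2 × Fin 2) ℂ) * homPoly (((0, 0) ::ₘ (0, 0) ::ₘ (1, 0) ::ₘ {(1, 0)}) :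
        Multiset (Fin 2 × Fin 1)) 2 ℂ = (2 : ℂ) • homPoly (((0, 0) ::ₘ (0, 0) ::ₘ (1, 0) ::ₘ {(1, 0)}) :
        Multiset (Fin 2 × Fin 1)) 2 ℂ from by rw [smul_eq_C_mul, map_ofNat]]
    exact Submodule.smul_mem _ _ (Submodule.subset_span ⟨2, 1, _, treewidth_F₁_le_one, rfl⟩)
  · rw [show (2 : MvPolynomial (Fin 2 × Fin 2) ℂ) * homPoly (((0, 0) ::ₘ (0, 0) ::ₘ (1, 0) ::ₘ {(1, 1)}) :
        Multiset (Fin 2 × Fin 2)) 2 ℂ = (2 : ℂ) • homPoly (((0, 0) ::ₘ (0, 0) ::ₘ (1, 0) ::ₘ {(1, 1)}) :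
        Multiset (Fin 2 × Fin 2)) 2 ℂ from by rw [smul_eq_C_mul, map_ofNat]]
    exact Submodule.smul_mem _ _ (Submodule.subset_span ⟨2, 2, _, treewidth_F₂_le_one, rfl⟩)
  · exact Submodule.subset_span ⟨2, 3, _, treewidth_F₃_le_one, rfl⟩

/-- **The `4`-cycle pattern itself has treewidth `≥ 2`**: otherwise its pattern graph would be acyclic
(`ForestBlind.isAcyclic_of_treewidth_lt_two`) and could not separate the forest-blind pair of
`…LinearWidthForestBlind.lean`, which it does (`24 ≠ 32`, `…FourCycleSeparates.lean`). [folklore] -/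
theorem two_le_treewidth_fourCycle :
    2 ≤ Literature.Combinatorics.SimpleGraph.treewidth
      (SimpleGraph.fromRel fun u v : Fin 2 ⊕ Fin 2 =>
        ∃ p ∈ (((0, 0) ::ₘ (0, 1) ::ₘ (1, 0) ::ₘ {(1, 1)}) : Multiset (Fin 2 × Fin 2)),
          u = Sum.inl p.1 ∧ v = Sum.inr p.2) := by
  classical
  by_contra hlt
  push Not at hlt
  have hac := ForestBlind.isAcyclic_of_treewidth_lt_two _ hlt
  have heq := ForestBlind.eval_homPoly_eq_of_isAcyclic
    (fun ij : Fin 4 × Fin 4 => (((![![1,1,0,0],![0,1,1,0],![0,0,1,1],![1,0,0,1]] : Fin 4 → Fin 4 → ℕ)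
      ij.1 ij.2 : ℕ) : ℂ))
    (fun ij : Fin 4 × Fin 4 => (((![![1,1,0,0],![1,1,0,0],![0,0,1,1],![0,0,1,1]] : Fin 4 → Fin 4 → ℕ)
      ij.1 ij.2 : ℕ) : ℂ))
    (fun m i i' => (ForestBlind.rows_cycle8 m i).trans (ForestBlind.rows_twoSquares m i').symm)
    (fun m j j' => (ForestBlind.cols_cycle8 m j).trans (ForestBlind.cols_twoSquares m j').symm)
    2 2 _ hac
  rw [ForestBlind.eval_homPoly_fourCycle, ForestBlind.eval_homPoly_fourCycle] at heq
  have h24 := ForestBlind.fourCycle_cycle8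
  have h32 := ForestBlind.fourCycle_twoSquares
  simp only at heq h24 h32
  rw [h24, h32] at heq
  norm_num at heq

end Folding

end Summit.ValiantsHypothesis.ValiantsHypothesis.Theorems

end
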